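import Mathlib
import Literature.AlgebraicGeometry.Resolution.CobordantGame
import Literature.AlgebraicGeometry.Resolution.CobordantChartCoefficients
import Literature.AlgebraicGeometry.Resolution.CobordantChartPlaneSlice
import Literature.AlgebraicGeometry.Resolution.PowerSeriesRegularLocal
import Literature.AlgebraicGeometry.Resolution.ChartTwoPolygonLaws
import Literature.AlgebraicGeometry.Resolution.FormalCoordinateChange
import Summits.ResolutionOfSingularities.ResolutionOfSingularities.Theorems.WeightedInvariantLocalWeightedDropChartTransportTwo
import Summits.ResolutionOfSingularities.ResolutionOfSingularities.Theorems.WeightedInvariantLocalWeightedDropPointChartBeta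

/-!
# `LocalWeightedDrop`: CJS Lemma 12.2 (3) on a game move — `α″ = α`, `β″ ≤ α + β − 1` at a near point of the `u₂`-chart

Route `ResolutionOfSingularities/WeightedInvariant`, crux `LocalWeightedDrop` (stmt-ResolutionOfSingularities-8899), line
`hasse-ridge-face-selection` (chain w43, [OURS · L1 W4.3]).  Companion of `…PointChartBeta` for the `u₂`-chart: the landed
Literature laws `ChartTwoPolygonLaws.alphaS_colon_two_eq` / `betaS_colon_two_add_le` applied to the game's point blow-up of
`f ∈ k[[X₀, X₁, X₂]]` at an exceptional point `c` with `c₂ ≠ 0`, sliced at the slot `2`, with the translated parameters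
`c̃ = (X₀ − (c₀/c₂) X₂, X₁ − (c₁/c₂) X₂, X₂)` and chart parameters `c′ = (c₂⁻¹ X₁, c₂⁻¹ X₂, c₂ X₀)` of `…ChartTransportTwo`:
`weakTransformTwo_eq_span_slice` (`((f) R′ : (φ u₂)^d) = (Sl)`), `alphaS_sliceTwo_eq`, `betaS_sliceTwo_add_le`.
-/

set_option linter.dupNamespace false -- mandated namespace of this single-conjunct summit

namespace Summit.ResolutionOfSingularities.ResolutionOfSingularities.Theorems

open Literature.AlgebraicGeometry.Resolution

namespace PointChartTransport

variable {k : Type} [Field k]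

/-- THE WEAK TRANSFORM OF THE `u₂`-CHART IS THE IDEAL OF THE SLICE: `((f) R′ : (φ u₂)^d) = (Sl)`, `u₂ = c̃₂ = X₂`. -/
theorem weakTransformTwo_eq_span_slice (c : Fin 3 → k) (hc2 : c 2 ≠ 0) (f : MvPowerSeries (Fin 3) k) (d : ℕ)
    (G : MvPowerSeries (Fin 4) k)
    (hfac : MvPowerSeries.subst (CobordantChart.chart (fun _ : Fin 3 => 1) c) f = MvPowerSeries.X 0 ^ d * G) :
    Submodule.colon (Ideal.map (MvPowerSeries.substAlgHom (R := k) (hasSubst_rhoTwo c)).toRingHom (Ideal.span {f}))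
        ({(MvPowerSeries.substAlgHom (R := k) (hasSubst_rhoTwo c)).toRingHom (MvPowerSeries.X 2 : MvPowerSeries (Fin 3) k) ^ d} :
          Set (MvPowerSeries (Fin 3) k)) =
      Ideal.span {MvPowerSeries.subst (fun j : Fin 4 => if j = (2 : Fin 3).succ then
        (0 : MvPowerSeries (Fin 3) k) else MvPowerSeries.X (Fin.predAbove (2 : Fin 3) j)) G} := by
  have hφ : ∀ x, (MvPowerSeries.substAlgHom (R := k) (hasSubst_rhoTwo c)).toRingHom x =
      MvPowerSeries.subst (fun l : Fin 3 => MvPowerSeries.X (0 : Fin 3) ^ ((fun _ : Fin 3 => 1) l) *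
        (MvPowerSeries.C (c l) + if l = (2 : Fin 3) then (0 : MvPowerSeries (Fin 3) k)
          else MvPowerSeries.X (Fin.predAbove (2 : Fin 3) l.succ))) x := fun x => by
    rw [AlgHom.toRingHom_eq_coe, RingHom.coe_coe, MvPowerSeries.coe_substAlgHom]
  rw [Ideal.map_span, Set.image_singleton, hφ, hφ, substTwo_rho_eq c hc2 f d G hfac, substTwo_ct_two,
    colon_span_singleton_mul, Ideal.span_singleton_mul_left_unit]
  · exact (MvPowerSeries.isUnit_iff_constantCoeff.mpr (by
      rw [MvPowerSeries.constantCoeff_C]; exact isUnit_iff_ne_zero.mpr (pow_ne_zero _ (inv_ne_zero hc2))))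
  · exact pow_ne_zero _ (mul_ne_zero (fun h => hc2 (MvPowerSeries.C_injective (h.trans (map_zero _).symm)))
      (FormalCoordChange.X_ne_zero' _))

/-- **`α″ = α` AND `β″ + d! ≤ α + β` AT A NEAR POINT OF THE `u₂`-CHART OF A GAME MOVE** (CJS Lemma 12.2 (3), Literature
`ChartTwoPolygonLaws.alphaS_colon_two_eq` / `betaS_colon_two_add_le`, instantiated; scaled integer invariants, `L = d!`). -/
theorem alphaS_betaS_sliceTwo (c : Fin 3 → k) (hc2 : c 2 ≠ 0) (f : MvPowerSeries (Fin 3) k) (d : ℕ)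
    (G : MvPowerSeries (Fin 4) k)
    (hfac : MvPowerSeries.subst (CobordantChart.chart (fun _ : Fin 3 => 1) c) f = MvPowerSeries.X 0 ^ d * G)
    (hJμ : Ideal.span {f} ≤ IsLocalRing.maximalIdeal (MvPowerSeries (Fin 3) k) ^ d)
    (hne : (pts (![MvPowerSeries.X 0 - MvPowerSeries.C (c 0 / c 2) * MvPowerSeries.X 2,
      MvPowerSeries.X 1 - MvPowerSeries.C (c 1 / c 2) * MvPowerSeries.X 2, MvPowerSeries.X 2] :
        Fin 3 → MvPowerSeries (Fin 3) k) (Ideal.span {f}) d).Nonempty)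
    (hδ : d.factorial < deltaS (![MvPowerSeries.X 0 - MvPowerSeries.C (c 0 / c 2) * MvPowerSeries.X 2,
      MvPowerSeries.X 1 - MvPowerSeries.C (c 1 / c 2) * MvPowerSeries.X 2, MvPowerSeries.X 2] :
        Fin 3 → MvPowerSeries (Fin 3) k) (Ideal.span {f}) d) :
    alphaS (![MvPowerSeries.C (c 2)⁻¹ * MvPowerSeries.X 1, MvPowerSeries.C (c 2)⁻¹ * MvPowerSeries.X 2,
        MvPowerSeries.C (c 2) * MvPowerSeries.X 0] : Fin 3 → MvPowerSeries (Fin 3) k)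
      (Ideal.span {MvPowerSeries.subst (fun j : Fin 4 => if j = (2 : Fin 3).succ then
        (0 : MvPowerSeries (Fin 3) k) else MvPowerSeries.X (Fin.predAbove (2 : Fin 3) j)) G}) d =
      alphaS (![MvPowerSeries.X 0 - MvPowerSeries.C (c 0 / c 2) * MvPowerSeries.X 2,
        MvPowerSeries.X 1 - MvPowerSeries.C (c 1 / c 2) * MvPowerSeries.X 2, MvPowerSeries.X 2] :
          Fin 3 → MvPowerSeries (Fin 3) k) (Ideal.span {f}) d ∧
    betaS (![MvPowerSeries.C (c 2)⁻¹ * MvPowerSeries.X 1, MvPowerSeries.C (c 2)⁻¹ * MvPowerSeries.X 2,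
        MvPowerSeries.C (c 2) * MvPowerSeries.X 0] : Fin 3 → MvPowerSeries (Fin 3) k)
      (Ideal.span {MvPowerSeries.subst (fun j : Fin 4 => if j = (2 : Fin 3).succ then
        (0 : MvPowerSeries (Fin 3) k) else MvPowerSeries.X (Fin.predAbove (2 : Fin 3) j)) G}) d + d.factorial ≤
      alphaS (![MvPowerSeries.X 0 - MvPowerSeries.C (c 0 / c 2) * MvPowerSeries.X 2,
        MvPowerSeries.X 1 - MvPowerSeries.C (c 1 / c 2) * MvPowerSeries.X 2, MvPowerSeries.X 2] :
          Fin 3 → MvPowerSeries (Fin 3) k) (Ideal.span {f}) d +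
      betaS (![MvPowerSeries.X 0 - MvPowerSeries.C (c 0 / c 2) * MvPowerSeries.X 2,
        MvPowerSeries.X 1 - MvPowerSeries.C (c 1 / c 2) * MvPowerSeries.X 2, MvPowerSeries.X 2] :
          Fin 3 → MvPowerSeries (Fin 3) k) (Ideal.span {f}) d := by
  haveI : IsRegularLocalRing (MvPowerSeries (Fin 3) k) := isRegularLocalRing_mvPowerSeries k (Fin 3)
  have hdim : ringKrullDim (MvPowerSeries (Fin 3) k) = 3 := by
    rw [ringKrullDim_mvPowerSeries, Nat.card_eq_fintype_card, Fintype.card_fin]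
    rfl
  set φ : MvPowerSeries (Fin 3) k →+* MvPowerSeries (Fin 3) k :=
    (MvPowerSeries.substAlgHom (R := k) (hasSubst_rhoTwo c)).toRingHom with hφdef
  have hφ : ∀ x, φ x = MvPowerSeries.subst (fun l : Fin 3 => MvPowerSeries.X (0 : Fin 3) ^ ((fun _ : Fin 3 => 1) l) *
      (MvPowerSeries.C (c l) + if l = (2 : Fin 3) then (0 : MvPowerSeries (Fin 3) k)
        else MvPowerSeries.X (Fin.predAbove (2 : Fin 3) l.succ))) x := fun x => by
    rw [hφdef, AlgHom.toRingHom_eq_coe, RingHom.coe_coe, MvPowerSeries.coe_substAlgHom]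
  set ct : Fin 3 → MvPowerSeries (Fin 3) k := ![MvPowerSeries.X 0 - MvPowerSeries.C (c 0 / c 2) * MvPowerSeries.X 2,
    MvPowerSeries.X 1 - MvPowerSeries.C (c 1 / c 2) * MvPowerSeries.X 2, MvPowerSeries.X 2] with hct
  set cp : Fin 3 → MvPowerSeries (Fin 3) k := ![MvPowerSeries.C (c 2)⁻¹ * MvPowerSeries.X 1,
    MvPowerSeries.C (c 2)⁻¹ * MvPowerSeries.X 2, MvPowerSeries.C (c 2) * MvPowerSeries.X 0] with hcp
  have hct0 : ct 0 = MvPowerSeries.X 0 - MvPowerSeries.C (c 0 / c 2) * MvPowerSeries.X 2 := rfl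
  have hct1 : ct 1 = MvPowerSeries.X 1 - MvPowerSeries.C (c 1 / c 2) * MvPowerSeries.X 2 := rfl
  have hct2 : ct 2 = MvPowerSeries.X 2 := rfl
  have hcp0 : cp 0 = MvPowerSeries.C (c 2)⁻¹ * MvPowerSeries.X 1 := rfl
  have hcp1 : cp 1 = MvPowerSeries.C (c 2)⁻¹ * MvPowerSeries.X 2 := rfl
  have hcp2 : cp 2 = MvPowerSeries.C (c 2) * MvPowerSeries.X 0 := rfl
  have h₂ : cp 2 = φ (ct 2) := by
    rw [hφ, hct2, hcp2, substTwo_ct_two]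
  have h₀ : φ (ct 0) = φ (ct 2) * cp 0 := by
    rw [hφ, hφ, hct0, hct2, hcp0, substTwo_ct_zero c hc2, substTwo_ct_two]
  have h₁ : φ (ct 1) = φ (ct 2) * cp 1 := by
    rw [hφ, hφ, hct1, hct2, hcp1, substTwo_ct_one c hc2, substTwo_ct_two]
  have hgen : Ideal.span {ct 0, ct 1, ct 2} = IsLocalRing.maximalIdeal _ := span_ctTwo_eq_maximalIdeal c
  have hgen' : Ideal.span {cp 0, cp 1, cp 2} = IsLocalRing.maximalIdeal _ := span_cprimeTwo_eq_maximalIdeal c hc2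
  have hJ'' : Submodule.colon (Ideal.map φ (Ideal.span {f})) ({φ (ct 2) ^ d} : Set (MvPowerSeries (Fin 3) k)) =
      Ideal.span {MvPowerSeries.subst (fun j : Fin 4 => if j = (2 : Fin 3).succ then
        (0 : MvPowerSeries (Fin 3) k) else MvPowerSeries.X (Fin.predAbove (2 : Fin 3) j)) G} := by
    rw [hφdef]
    exact weakTransformTwo_eq_span_slice c hc2 f d G hfac
  have keyα := alphaS_colon_two_eq φ h₂ h₀ h₁ hgen hdim hgen' hdim hJμ hne hδ
  have keyβ := betaS_colon_two_add_le φ h₂ h₀ h₁ hgen hdim hgen' hdim hJμ hne hδ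
  rw [hJ''] at keyα keyβ
  exact ⟨keyα, keyβ⟩

end PointChartTransport

end Summit.ResolutionOfSingularities.ResolutionOfSingularities.Theorems
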